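import Summits.CriticalPhenomena.PercolationContinuityZ3.Theorems.PercNearOneGluingAdditiveGluingAGlocPair
import HarnessLib

/-!
# Crux `PercNearOneGluing.AdditiveGluing` (stmt-CriticalPhenomena-4576): the localised union bound (AG-loc) in FIRST-IN-RANK form for `|A| ≤ 2`

Support file (`--supports stmt-CriticalPhenomena-4576`, lead-of-record prim-png-lead-4576 gen 6).  No named facts, no sorries, no definitions.

The proposed one-stub line `agloc` (lead's skeleton `AdditiveGluing_agloc.lean`, attached to the item) states (AG-loc) in the 'first-in-rank' form: for a rank
`r : Fin n → ℕ` injective on `A` with less reliable relays first (`r a < r a' → μ(a ↔ b) ≤ μ(a' ↔ b)`) and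
`P_a := {o ↔ a} ∩ ⋂_{a' ∈ A, r a' < r a} {o ↮ a'}`,
      `μ(o ↔ A, o ↮ b) ≤ Σ_{a ∈ A} μ(P_a) · (1 − μ(a ↔ b))`.
THIS FILE PROVES THAT STUB FOR `A.card ≤ 2` (`AGloc.agloc_firstRank_card_le_two`) from the tree theorem `AGloc.agloc_pair_compl` (|A| = 2) and the trivial
cases `A = ∅`, `A = {a}` (union bound = Harris is not even needed: `μ(o↔a, o↮b) ≤ μ(o↔a)·μ(a↮b)` is `AGloc.agloc_single` rearranged).
[cite: KozmaNitzan2024, Thm. 1 (pp. 7–8)]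
-/

noncomputable section

namespace Summit.CriticalPhenomena.PercolationContinuityZ3.Theorems.AGloc

open MeasureTheory Set Finset
open Literature.Probability.LatticeModels (prodBernoulli)
open Literature.Probability.Percolation

variable {n : ℕ}

/-- `|A| = 1`: `μ(o ↔ a, o ↮ b) ≤ μ(o ↔ a)·(1 − μ(a ↔ b))` (Harris, via `agloc_single`). [cite: KozmaNitzan2024, §2.1 (p. 5, FKG/Harris)] -/
theorem agloc_single_compl (w : Sym2 (Fin n) → unitInterval) (o b a : Fin n) :
    (prodBernoulli w).real (openConn o a ∩ (openConn o b)ᶜ : Set (BondConfig (Fin n))) ≤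
      (prodBernoulli w).real (openConn o a) * (1 - (prodBernoulli w).real (openConn a b)) := by
  classical
  have h := agloc_single w o b a
  have hmeas : ∀ S : Set (BondConfig (Fin n)), MeasurableSet S := fun S => (Set.toFinite S).measurableSet
  have hs : (prodBernoulli w).real (openConn o a) =
      (prodBernoulli w).real (openConn o a ∩ openConn o b : Set (BondConfig (Fin n))) +
        (prodBernoulli w).real (openConn o a ∩ (openConn o b)ᶜ : Set (BondConfig (Fin n))) := by
    rw [← measureReal_inter_add_sdiff (s := (openConn o a : Set (BondConfig (Fin n)))) (h := measure_ne_top _ _)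
      (hmeas (openConn o b)), Set.sdiff_eq]
  rw [show (openConn o b ∩ openConn o a : Set (BondConfig (Fin n))) = openConn o a ∩ openConn o b from Set.inter_comm _ _] at h
  nlinarith [h, hs]

/-- **(AG-loc), first-in-rank form, for `A.card ≤ 2`.**  The `|A| ≤ 2` rung of the proposed stub `stub_agloc` of the line `agloc`.
[cite: KozmaNitzan2024, Thm. 1 (pp. 7–8)] -/
theorem agloc_firstRank_card_le_two (w : Sym2 (Fin n) → unitInterval) (A : Finset (Fin n)) (o b : Fin n) (r : Fin n → ℕ)
    (hA : A.card ≤ 2) (hr : Set.InjOn r ↑A)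
    (hcompat : ∀ a ∈ A, ∀ a' ∈ A, r a < r a' →
      (prodBernoulli w).real (openConn a b) ≤ (prodBernoulli w).real (openConn a' b)) :
    (prodBernoulli w).real ((⋃ a ∈ A, openConn o a) ∩ (openConn o b)ᶜ : Set (BondConfig (Fin n))) ≤
      ∑ a ∈ A, (prodBernoulli w).real
          (openConn o a ∩ ⋂ a' ∈ A.filter (fun a' => r a' < r a), (openConn o a')ᶜ : Set (BondConfig (Fin n))) *
        (1 - (prodBernoulli w).real (openConn a b)) := by
  classical
  set μ := prodBernoulli w with hμ
  -- the pattern of a rank-minimal element is `{o ↔ a}`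
  have hpat_min : ∀ a ∈ A, (∀ a' ∈ A, ¬ r a' < r a) →
      (openConn o a ∩ ⋂ a' ∈ A.filter (fun a' => r a' < r a), (openConn o a')ᶜ : Set (BondConfig (Fin n))) = openConn o a := by
    intro a _ hmin
    have hf : A.filter (fun a' => r a' < r a) = ∅ := by
      rw [Finset.filter_eq_empty_iff]
      exact fun a' ha' => hmin a' ha'
    rw [hf]
    simp
  rcases Nat.lt_or_ge A.card 1 with h0 | h1
  · -- `A = ∅`
    have hA0 : A = ∅ := Finset.card_eq_zero.1 (Nat.lt_one_iff.1 h0)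
    subst hA0
    simp
  rcases Nat.lt_or_ge A.card 2 with h1' | h2
  · -- `A = {a}`
    obtain ⟨a, rfl⟩ := Finset.card_eq_one.1 (le_antisymm (Nat.le_of_lt_succ h1') h1)
    rw [Finset.sum_singleton, hpat_min a (Finset.mem_singleton_self a) (fun a' ha' => by
      rw [Finset.mem_singleton] at ha'; subst ha'; exact lt_irrefl _)]
    simpa using agloc_single_compl w o b a
  · -- `A = {a₁, a₂}` with `r a₁ < r a₂` (after relabelling)
    have hA2 : A.card = 2 := le_antisymm hA h2
    obtain ⟨x, y, hxy, rfl⟩ := Finset.card_eq_two.1 hA2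
    -- choose the rank order
    have hne : r x ≠ r y := fun h => hxy (hr (by simp) (by simp) h)
    -- a symmetric auxiliary statement
    have key : ∀ a₁ a₂ : Fin n, a₁ ≠ a₂ → r a₁ < r a₂ →
        (μ.real (openConn a₁ b) ≤ μ.real (openConn a₂ b)) →
        μ.real ((⋃ a ∈ ({a₁, a₂} : Finset (Fin n)), openConn o a) ∩ (openConn o b)ᶜ : Set (BondConfig (Fin n))) ≤
          ∑ a ∈ ({a₁, a₂} : Finset (Fin n)), μ.real
              (openConn o a ∩ ⋂ a' ∈ ({a₁, a₂} : Finset (Fin n)).filter (fun a' => r a' < r a), (openConn o a')ᶜ :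
                Set (BondConfig (Fin n))) *
            (1 - μ.real (openConn a b)) := by
      intro a₁ a₂ h12 hr12 hτ
      rw [Finset.sum_pair h12]
      have hf1 : ({a₁, a₂} : Finset (Fin n)).filter (fun a' => r a' < r a₁) = ∅ := by
        rw [Finset.filter_eq_empty_iff]
        intro a' ha'
        simp only [Finset.mem_insert, Finset.mem_singleton] at ha'
        rcases ha' with rfl | rfl
        · exact lt_irrefl _
        · exact lt_asymm hr12
      have hf2 : ({a₁, a₂} : Finset (Fin n)).filter (fun a' => r a' < r a₂) = {a₁} := by
        ext a'
        simp only [Finset.mem_filter, Finset.mem_insert, Finset.mem_singleton]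
        constructor
        · rintro ⟨h | h, hlt⟩
          · exact h
          · subst h; exact absurd hlt (lt_irrefl _)
        · intro h; subst h; exact ⟨Or.inl rfl, hr12⟩
      rw [hf1, hf2]
      have hU : (⋃ a ∈ ({a₁, a₂} : Finset (Fin n)), (openConn o a : Set (BondConfig (Fin n)))) = openConn o a₁ ∪ openConn o a₂ := by
        ext ω
        simp only [Set.mem_iUnion, Finset.mem_insert, Finset.mem_singleton, Set.mem_union, exists_prop]
        constructor
        · rintro ⟨a, (rfl | rfl), h⟩
          · exact Or.inl h
          · exact Or.inr h
        · rintro (h | h)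
          · exact ⟨a₁, Or.inl rfl, h⟩
          · exact ⟨a₂, Or.inr rfl, h⟩
      rw [hU]
      have h2 : (openConn o a₂ ∩ ⋂ a' ∈ ({a₁} : Finset (Fin n)), (openConn o a')ᶜ : Set (BondConfig (Fin n))) =
          openConn o a₂ ∩ (openConn o a₁)ᶜ := by
        ext ω; simp
      rw [h2]
      simpa using agloc_pair_compl w o b a₁ a₂ hτ
    rcases lt_or_gt_of_ne hne with hlt | hgt
    · exact key x y hxy hlt (hcompat x (by simp) y (by simp) hlt)
    · have hswap : ({x, y} : Finset (Fin n)) = {y, x} := Finset.pair_comm x y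
      rw [hswap]
      exact key y x (Ne.symm hxy) hgt (hcompat y (by simp) x (by simp) hgt)

end Summit.CriticalPhenomena.PercolationContinuityZ3.Theorems.AGloc

end
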